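import Literature.AlgebraicGeometry.Frobenioids.QuasiTemperoidOrbits
import HarnessLib

/-!
# Frobenioids II, Example 1.3 (i): proofs of the named claims of `QuasiTemperoid.lean` about `E⁰`

Mochizuki, *The geometry of Frobenioids II*, Kyushu J. Math. **62** (2008) 401–460, §1 Example 1.3
(i), author's text p. 11 [cite: MochizukiFrdII2008, Ex 1.3 (i) p.11]: "One verifies immediately that
if `E` is a connected quasi-temperoid, then the category `E⁰ (⊆ E)` is connected, totally
epimorphic, of strongly indissectible type [cf. §0], and of FSM-type [indeed, every monomorphism of
`E⁰` is an isomorphism], hence, in particular, of FSMFF-type".  The statement file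
`Literature.AlgebraicGeometry.Frobenioids.QuasiTemperoid` records these sentences, for
`E = B^temp(Π, Π°)` (`BTempRel Π Π°`, `Π` tempered, `Π° ⊆ Π` open), as the named facts
`ConnectedPartIsConnected`, `ConnectedPartIsTotallyEpimorphic`,
`ConnectedPartIsOfStronglyIndissectibleType`, `ConnectedPartMonoIsIso`, `ConnectedPartIsOfFSMFFType`;
this proof-only companion discharges all five (`…_holds`), over the orbit description of the
connected objects in `QuasiTemperoidOrbits.lean`.  The test objects are the coset spaces `Π/V`,
`V ⊆ Π` open (objects of `B^temp(Π)` by [SemiAnbd] Rmk 3.1.2, L3's `temperedAction_quotient_iff`).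

A point of bookkeeping not spelled out in print: the dissection vocabulary of [FrdII] §0 quantifies
over *non-initial* test objects of `E⁰`; we show that `E⁰` has an initial object only when `Π` is
trivial, in which case every object of `E⁰` is initial, so that the printed claim holds as typed in
all cases.  Proof-only: no definitions.
-/

open CategoryTheory CategoryTheory.Limits Topology
open Literature.AnabelianGeometry.SemiGraphs

namespace Literature.AlgebraicGeometry.Frobenioids

namespace QuasiTemperoid

universe u

variable {G : Type u} [Group G] [TopologicalSpace G] {H : Subgroup G}

open BTempRel


/-! ### The coset spaces `Π/V` as objects of `B^temp(Π, Π°)` -/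

/-- For `Π` tempered, `T` an object of `B^temp(Π, Π°)` with a point `x`, and `V ⊆ Π` an open subgroup
fixing `x`, the coset space `Π/V` is a connected object of `B^temp(Π, Π°)` mapping to `T` with
`1 · V ↦ x`; it is the orbit of a point with stabiliser exactly `V` ([SemiAnbd] Rmk 3.1.2 for
membership in `B^temp(Π)`). [cite: MochizukiFrdII2008, Ex 1.3 (i) p.11] -/
private theorem exists_cosetObj [IsTopologicalGroup G] (hG : IsTempered G) (T : BTempRel G H)
    (x : T.obj.obj.V) (V : Subgroup G) (hV : IsOpen (V : Set G))
    (hVx : ∀ g ∈ V, T.obj.obj.ρ g x = x) :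
    ∃ (R : BTempRel G H) (r₀ : R.obj.obj.V) (p : R ⟶ T), IsConnectedObj R ∧
      (p.hom.hom.hom r₀ : T.obj.obj.V) = x ∧ (∀ r : R.obj.obj.V, ∃ g : G, R.obj.obj.ρ g r₀ = r) ∧
      ∀ g : G, R.obj.obj.ρ g r₀ = r₀ ↔ g ∈ V := by
  obtain ⟨t⟩ := T.property
  -- the orbit map `Π/V → T`, `gV ↦ g · x`
  let ψ : G ⧸ V → T.obj.obj.V := fun q => Quotient.liftOn' q (fun g : G => T.obj.obj.ρ g x)
    fun a b hab => by
      have hab' : a⁻¹ * b ∈ V := QuotientGroup.leftRel_apply.mp hab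
      change T.obj.obj.ρ a x = T.obj.obj.ρ b x
      have := hVx _ hab'
      rw [ρ_mul_apply] at this
      have h := congrArg (T.obj.obj.ρ a) this
      rw [← ρ_mul_apply, mul_inv_cancel, ρ_one_apply] at h
      exact h.symm
  have hψ : ∀ g : G, ψ (g : G ⧸ V) = T.obj.obj.ρ g x := fun _ => rfl
  let pA : cosetAction G V ⟶ T.obj.obj :=
    { hom := TypeCat.ofHom ψ
      comm := fun g => by
        apply ConcreteCategory.hom_ext
        intro q
        obtain ⟨a, rfl⟩ := QuotientGroup.mk_surjective q
        change ψ (g • (a : G ⧸ V)) = T.obj.obj.ρ g (ψ a)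
        rw [MulAction.Quotient.smul_coe, smul_eq_mul, hψ, hψ, ρ_mul_apply] }
  let R : BTempRel G H := ⟨cosetObj G hG V hV, ⟨pA ≫ t⟩⟩
  have hρR : ∀ (g a : G), R.obj.obj.ρ g (a : G ⧸ V) = ((g * a : G) : G ⧸ V) := fun g a => by
    change g • (a : G ⧸ V) = _
    rw [MulAction.Quotient.smul_coe, smul_eq_mul]
  have htr : ∀ r : R.obj.obj.V, ∃ g : G, R.obj.obj.ρ g ((1 : G) : G ⧸ V) = r := fun r => by
    obtain ⟨a, rfl⟩ := QuotientGroup.mk_surjective r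
    exact ⟨a, by rw [hρR, mul_one]⟩
  refine ⟨R, ((1 : G) : G ⧸ V), ObjectProperty.homMk (ObjectProperty.homMk pA),
    isConnectedObj_of_transitive R _ htr, ?_, htr, fun g => ?_⟩
  · change ψ ((1 : G) : G ⧸ V) = x
    rw [hψ, ρ_one_apply]
  · rw [hρR, mul_one]
    change ((g : G) : G ⧸ V) = ((1 : G) : G ⧸ V) ↔ g ∈ V
    rw [QuotientGroup.eq, mul_one, inv_mem_iff]

/-- Test objects: two pointed objects of `B^temp(Π, Π°)` receive morphisms from a common connected
object `Π/V` (`V` the intersection of the two stabilisers) hitting the two points.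
[cite: MochizukiFrdII2008, Ex 1.3 (i) p.11] -/
private theorem exists_testObj [IsTopologicalGroup G] (hG : IsTempered G) (T₁ T₂ : BTempRel G H)
    (x₁ : T₁.obj.obj.V) (x₂ : T₂.obj.obj.V) :
    ∃ (R : BTempRel G H) (r₀ : R.obj.obj.V) (a : R ⟶ T₁) (b : R ⟶ T₂), IsConnectedObj R ∧
      (a.hom.hom.hom r₀ : T₁.obj.obj.V) = x₁ ∧ (b.hom.hom.hom r₀ : T₂.obj.obj.V) = x₂ := by
  -- the two stabilisers as subgroups
  let S₁ : Subgroup G :=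
    { carrier := {g : G | T₁.obj.obj.ρ g x₁ = x₁}
      mul_mem' := fun {a b} ha hb => by
        change T₁.obj.obj.ρ (a * b) x₁ = x₁
        rw [ρ_mul_apply, hb, ha]
      one_mem' := ρ_one_apply T₁ x₁
      inv_mem' := fun {a} ha => by
        change T₁.obj.obj.ρ a⁻¹ x₁ = x₁
        conv_lhs => rw [← ha]
        rw [ρ_inv_apply] }
  let S₂ : Subgroup G :=
    { carrier := {g : G | T₂.obj.obj.ρ g x₂ = x₂}
      mul_mem' := fun {a b} ha hb => by
        change T₂.obj.obj.ρ (a * b) x₂ = x₂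
        rw [ρ_mul_apply, hb, ha]
      one_mem' := ρ_one_apply T₂ x₂
      inv_mem' := fun {a} ha => by
        change T₂.obj.obj.ρ a⁻¹ x₂ = x₂
        conv_lhs => rw [← ha]
        rw [ρ_inv_apply] }
  have hS : IsOpen ((S₁ ⊓ S₂ : Subgroup G) : Set G) :=
    (T₁.obj.property.2 x₁).inter (T₂.obj.property.2 x₂)
  obtain ⟨R, r₀, a, hR, ha, htr, hstab⟩ :=
    exists_cosetObj hG T₁ x₁ (S₁ ⊓ S₂) hS fun g hg => hg.1
  obtain ⟨b, hb⟩ := exists_hom_of_stabilizer_le (T₂ := T₂) r₀ htr x₂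
    fun g hg => ((hstab g).mp hg).2
  exact ⟨R, r₀, a, b, hR, ha, hb⟩

/-! ### The degenerate case: initial objects of `E⁰` -/

/-- If `E⁰ = B^temp(Π, Π°)⁰` has an initial object `Q`, then `Π` is trivial: the stabiliser `W` of a
point of `Q` is contained in every open normal subgroup (map `Q` to `Π/(W ∩ N)`), hence is trivial
(`Π` is separated by its open normal subgroups), so right translations by arbitrary `n ∈ Π` are
endomorphisms of `Q`, all equal to the identity. [folklore] -/
private theorem eq_one_of_isInitial [IsTopologicalGroup G] (hG : IsTempered G)
    (Q : ConnectedPart (BTempRel G H)) (hQ : IsInitial Q) (n : G) : n = 1 := by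
  obtain ⟨q₀⟩ := nonempty_of_isConnectedObj Q.obj Q.property
  have hW : IsOpen {g : G | Q.obj.obj.obj.ρ g q₀ = q₀} := Q.obj.obj.property.2 q₀
  have htrQ := exists_ρ_eq_of_isConnectedObj Q.obj Q.property q₀
  -- Step 1: the stabiliser of `q₀` lies in every open normal subgroup
  have step1 : ∀ (N : OpenNormalSubgroup G) (w : G), Q.obj.obj.obj.ρ w q₀ = q₀ → w ∈ N := by
    intro N w hw
    let WN : Subgroup G :=
      { carrier := {g : G | Q.obj.obj.obj.ρ g q₀ = q₀ ∧ g ∈ N}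
        mul_mem' := fun {a b} ha hb =>
          ⟨by rw [ρ_mul_apply, hb.1, ha.1], N.toSubgroup.mul_mem ha.2 hb.2⟩
        one_mem' := ⟨ρ_one_apply Q.obj q₀, N.toSubgroup.one_mem⟩
        inv_mem' := fun {a} ha =>
          ⟨by conv_lhs => rw [← ha.1]
              rw [ρ_inv_apply], N.toSubgroup.inv_mem ha.2⟩ }
    obtain ⟨R, r₀, p, hR, -, htr, hstab⟩ :=
      exists_cosetObj hG Q.obj q₀ WN (hW.inter N.isOpen) fun g hg => hg.1
    let m : Q ⟶ ⟨R, hR⟩ := hQ.to ⟨R, hR⟩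
    obtain ⟨c, hc⟩ := htr (m.hom.hom.hom.hom q₀)
    have h1 : R.obj.obj.ρ w (m.hom.hom.hom.hom q₀) = m.hom.hom.hom.hom q₀ := by
      rw [← hom_ρ m.hom w q₀, hw]
    rw [← hc, ← ρ_mul_apply] at h1
    have h2 : R.obj.obj.ρ (c⁻¹ * (w * c)) r₀ = r₀ := by
      rw [ρ_mul_apply, h1, ρ_inv_apply]
    have h3 : c⁻¹ * (w * c) ∈ N := ((hstab _).mp h2).2
    have h4 := N.isNormal'.conj_mem _ h3 c
    rwa [← mul_assoc, ← mul_assoc, mul_inv_cancel, one_mul, mul_assoc, mul_inv_cancel,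
      mul_one] at h4
  -- Step 2: the stabiliser of `q₀` is trivial
  have step2 : ∀ w : G, Q.obj.obj.obj.ρ w q₀ = q₀ → w = 1 := fun w hw => by
    by_contra hne
    obtain ⟨N, hN⟩ := hG.separated w hne
    exact hN (step1 N w hw)
  -- Step 3: right translation by `n` is an endomorphism of `Q`, hence the identity
  obtain ⟨e, he⟩ := exists_hom_of_stabilizer_le (T₂ := Q.obj) q₀ htrQ (Q.obj.obj.obj.ρ n q₀)
    fun g hg => by rw [step2 g hg, ρ_one_apply]
  have hid : (ObjectProperty.homMk e : Q ⟶ Q) = 𝟙 Q := hQ.hom_ext _ _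
  have h5 : Q.obj.obj.obj.ρ n q₀ = q₀ := by
    rw [← he]
    change ((ObjectProperty.homMk e : Q ⟶ Q).hom.hom.hom.hom q₀ : Q.obj.obj.obj.V) = q₀
    rw [hid]
    rfl
  exact step2 n h5

/-- The dissection vocabulary of [FrdII] §0 only tests against non-initial objects; in `E⁰` this is
harmless: if one object of `E⁰` is non-initial then all are (an initial object forces `Π = 1`, and
then every object of `E⁰` is a point, hence initial). [folklore] -/
private theorem isNonemptyObj_of_isNonemptyObj [IsTopologicalGroup G] (hG : IsTempered G)
    (X₀ Q : ConnectedPart (BTempRel G H)) (hX₀ : IsNonemptyObj X₀) : IsNonemptyObj Q := by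
  constructor
  intro hQ
  have htriv := eq_one_of_isInitial hG Q hQ
  obtain ⟨x₀⟩ := nonempty_of_isConnectedObj X₀.obj X₀.property
  have htrX := exists_ρ_eq_of_isConnectedObj X₀.obj X₀.property x₀
  -- every object of `E⁰` is a point
  have hpt : ∀ (Y : ConnectedPart (BTempRel G H)) (y y' : Y.obj.obj.obj.V), y = y' := by
    intro Y y y'
    obtain ⟨g, rfl⟩ := exists_ρ_eq_of_isConnectedObj Y.obj Y.property y y'
    rw [htriv g, ρ_one_apply]
  -- so `X₀` is initial
  have hex : ∀ Y : ConnectedPart (BTempRel G H), ∃ f : X₀.obj ⟶ Y.obj, True := fun Y => by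
    obtain ⟨y₀⟩ := nonempty_of_isConnectedObj Y.obj Y.property
    obtain ⟨f, -⟩ := exists_hom_of_stabilizer_le (T₂ := Y.obj) x₀ htrX y₀
      fun g _ => by rw [htriv g, ρ_one_apply]
    exact ⟨f, trivial⟩
  apply hX₀.false
  exact IsInitial.ofUniqueHom (fun Y => ObjectProperty.homMk (hex Y).choose) fun Y m =>
    ObjectProperty.hom_ext _ (hom_ext_apply fun x => hpt Y _ _)

/-! ### Example 1.3 (i): the five claims about `E⁰` -/

variable (G)

/-- **Example 1.3 (i)** (FrdII p. 11), PROVED: "the category `E⁰` is connected", for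
`E = B^temp(Π, Π°)`: `E⁰` contains `Π/Π°`, and two single orbits `X`, `Y` are joined by the zigzag
`X ← Π/(Π_x ∩ Π_y) → Y` through the intersection of two stabilisers.
[cite: MochizukiFrdII2008, Ex 1.3 (i) p.11] -/
theorem connectedPartIsConnected_holds : ConnectedPartIsConnected G := by
  intro _ hG H hH
  let TH : BTempRel G H := ⟨cosetObj G hG H hH, ⟨𝟙 _⟩⟩
  have hTH : IsConnectedObj TH := by
    refine isConnectedObj_of_transitive TH ((1 : G) : G ⧸ H) fun r => ?_
    obtain ⟨a, rfl⟩ := QuotientGroup.mk_surjective r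
    refine ⟨a, ?_⟩
    change a • ((1 : G) : G ⧸ H) = (a : G ⧸ H)
    rw [MulAction.Quotient.smul_coe, smul_eq_mul, mul_one]
  haveI : Nonempty (ConnectedPart (BTempRel G H)) := ⟨⟨TH, hTH⟩⟩
  refine zigzag_isConnected fun X Y => ?_
  obtain ⟨x⟩ := nonempty_of_isConnectedObj X.obj X.property
  obtain ⟨y⟩ := nonempty_of_isConnectedObj Y.obj Y.property
  obtain ⟨R, r₀, a, b, hR, -, -⟩ := exists_testObj hG X.obj Y.obj x y
  exact (Zigzag.of_inv (ObjectProperty.homMk a : (⟨R, hR⟩ : ConnectedPart (BTempRel G H)) ⟶ X)).trans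
    (Zigzag.of_hom (ObjectProperty.homMk b : (⟨R, hR⟩ : ConnectedPart (BTempRel G H)) ⟶ Y))

/-- `ConnectedPartIsConnected` — `_holds` alias of `connectedPartIsConnected_holds` above under the fact's exact name (appended
2026-08-28, D-0026 bookkeeping: the proof term is the existing theorem of this file; no statement,
definition or attribute is edited; no new named fact; the ledger's debt table listed the fact
unproved). [cite: MochizukiFrdII2008, Ex 1.3 (i) p.11] -/
theorem _root_.Literature.AlgebraicGeometry.Frobenioids.QuasiTemperoid.ConnectedPartIsConnected_holds :
    ConnectedPartIsConnected G :=
  _root_.Literature.AlgebraicGeometry.Frobenioids.QuasiTemperoid.connectedPartIsConnected_holds (G := G)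

/-- **Example 1.3 (i)** (FrdII p. 11), PROVED: "`E⁰` is … totally epimorphic": a `Π`-map between
single orbits is surjective, hence right-cancellable. [cite: MochizukiFrdII2008, Ex 1.3 (i) p.11] -/
theorem connectedPartIsTotallyEpimorphic_holds : ConnectedPartIsTotallyEpimorphic G := by
  intro _ hG H hH
  refine ⟨fun {X Y} f => ⟨fun {Z} g₁ g₂ h => ?_⟩⟩
  obtain ⟨x⟩ := nonempty_of_isConnectedObj X.obj X.property
  apply ObjectProperty.hom_ext
  apply hom_ext_apply
  intro y
  obtain ⟨x', hx'⟩ := surjective_of_isConnectedObj x Y.property f.hom y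
  have e := congrArg (fun k : X ⟶ Z => (k.hom.hom.hom.hom x' : Z.obj.obj.obj.V)) h
  change (g₁.hom.hom.hom.hom (f.hom.hom.hom.hom x') : Z.obj.obj.obj.V) =
    g₂.hom.hom.hom.hom (f.hom.hom.hom.hom x') at e
  rw [hx'] at e
  exact e

/-- `ConnectedPartIsTotallyEpimorphic` — `_holds` alias of `connectedPartIsTotallyEpimorphic_holds` above under the fact's exact name (appended
2026-08-28, D-0026 bookkeeping: the proof term is the existing theorem of this file; no statement,
definition or attribute is edited; no new named fact; the ledger's debt table listed the fact
unproved). [cite: MochizukiFrdII2008, Ex 1.3 (i) p.11] -/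
theorem _root_.Literature.AlgebraicGeometry.Frobenioids.QuasiTemperoid.ConnectedPartIsTotallyEpimorphic_holds :
    ConnectedPartIsTotallyEpimorphic G :=
  _root_.Literature.AlgebraicGeometry.Frobenioids.QuasiTemperoid.connectedPartIsTotallyEpimorphic_holds (G := G)

/-- **Example 1.3 (i)** (FrdII p. 11), PROVED: "[indeed, every monomorphism of `E⁰` is an
isomorphism]": a monomorphism `f : X → Y` of single orbits is injective (test it against the two
maps `Π/(Π_x ∩ Π_{x'}) → X` hitting `x`, `x'` with `f(x) = f(x')`) and surjective, hence
bijective, hence invertible in the full subcategory `E⁰`. [cite: MochizukiFrdII2008, Ex 1.3 (i) p.11] -/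
theorem connectedPartMonoIsIso_holds : ConnectedPartMonoIsIso G := by
  intro _ hG H hH X Y f hf
  obtain ⟨x₀⟩ := nonempty_of_isConnectedObj X.obj X.property
  have hinj : Function.Injective (fun x => (f.hom.hom.hom.hom x : Y.obj.obj.obj.V)) := by
    intro x₁ x₂ h12
    obtain ⟨R, r₀, a, b, hR, ha, hb⟩ := exists_testObj hG X.obj X.obj x₁ x₂
    let a' : (⟨R, hR⟩ : ConnectedPart (BTempRel G H)) ⟶ X := ObjectProperty.homMk a
    let b' : (⟨R, hR⟩ : ConnectedPart (BTempRel G H)) ⟶ X := ObjectProperty.homMk b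
    have hab : a' ≫ f = b' ≫ f := by
      apply ObjectProperty.hom_ext
      apply hom_eq_of_apply_eq hR _ _ r₀
      change (f.hom.hom.hom.hom (a.hom.hom.hom r₀) : Y.obj.obj.obj.V) =
        f.hom.hom.hom.hom (b.hom.hom.hom r₀)
      rw [ha, hb]
      exact h12
    have h := congrArg (fun k : (⟨R, hR⟩ : ConnectedPart (BTempRel G H)) ⟶ X =>
      (k.hom.hom.hom.hom r₀ : X.obj.obj.obj.V)) ((cancel_mono f).mp hab)
    change (a.hom.hom.hom r₀ : X.obj.obj.obj.V) = b.hom.hom.hom r₀ at h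
    rwa [ha, hb] at h
  have hsurj : Function.Surjective (fun x => (f.hom.hom.hom.hom x : Y.obj.obj.obj.V)) :=
    fun y => surjective_of_isConnectedObj x₀ Y.property f.hom y
  haveI : IsIso f.hom.hom.hom.hom := (isIso_iff_bijective _).mpr ⟨hinj, hsurj⟩
  haveI : IsIso f.hom.hom.hom := inferInstance
  haveI : IsIso f.hom.hom := (ObjectProperty.isIso_hom_iff _).mp inferInstance
  haveI : IsIso f.hom := (ObjectProperty.isIso_hom_iff _).mp inferInstance
  exact (ObjectProperty.isIso_hom_iff _).mp inferInstance

/-- `ConnectedPartMonoIsIso` — `_holds` alias of `connectedPartMonoIsIso_holds` above under the fact's exact name (appended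
2026-08-28, D-0026 bookkeeping: the proof term is the existing theorem of this file; no statement,
definition or attribute is edited; no new named fact; the ledger's debt table listed the fact
unproved). [cite: MochizukiFrdII2008, Ex 1.3 (i) p.11] -/
theorem _root_.Literature.AlgebraicGeometry.Frobenioids.QuasiTemperoid.ConnectedPartMonoIsIso_holds :
    ConnectedPartMonoIsIso G :=
  _root_.Literature.AlgebraicGeometry.Frobenioids.QuasiTemperoid.connectedPartMonoIsIso_holds (G := G)

/-- **Example 1.3 (i)** (FrdII p. 11), PROVED: "`E⁰` is … of FSM-type, hence, in particular, of
FSMFF-type" — from `connectedPartMonoIsIso_holds` by the implication recorded in the statement file.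
[cite: MochizukiFrdII2008, Ex 1.3 (i) p.11] -/
theorem connectedPartIsOfFSMFFType_holds : ConnectedPartIsOfFSMFFType G :=
  connectedPartIsOfFSMFFType_of G (connectedPartMonoIsIso_holds G)

/-- `ConnectedPartIsOfFSMFFType` — `_holds` alias of `connectedPartIsOfFSMFFType_holds` above under the fact's exact name (appended
2026-08-28, D-0026 bookkeeping: the proof term is the existing theorem of this file; no statement,
definition or attribute is edited; no new named fact; the ledger's debt table listed the fact
unproved). [cite: MochizukiFrdII2008, Ex 1.3 (i) p.11] -/
theorem _root_.Literature.AlgebraicGeometry.Frobenioids.QuasiTemperoid.ConnectedPartIsOfFSMFFType_holds :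
    ConnectedPartIsOfFSMFFType G :=
  _root_.Literature.AlgebraicGeometry.Frobenioids.QuasiTemperoid.connectedPartIsOfFSMFFType_holds (G := G)

/-- **Example 1.3 (i)** (FrdII p. 11), PROVED: "`E⁰` is … of strongly indissectible type [cf. §0]":
no object `A` of `E⁰` is weakly dissectible — given `φ₀ : X₀ → A`, `φ₁ : X₁ → A` and points
`x₀`, `x₁` over a common point of `A`, the two maps `Π/(Π_{x₀} ∩ Π_{x₁}) → Xᵢ` have equal
composites to `A` (and their source is non-initial as soon as `X₀` is).
[cite: MochizukiFrdII2008, Ex 1.3 (i) p.11] -/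
theorem connectedPartIsOfStronglyIndissectibleType_holds :
    ConnectedPartIsOfStronglyIndissectibleType G := by
  intro _ hG H hH
  refine ⟨fun A => ?_⟩
  rintro ⟨X, φ, hne, hsep⟩
  obtain ⟨x₀⟩ := nonempty_of_isConnectedObj (X 0).obj (X 0).property
  obtain ⟨x₁'⟩ := nonempty_of_isConnectedObj (X 1).obj (X 1).property
  obtain ⟨x₁, hx₁⟩ :=
    surjective_of_isConnectedObj x₁' A.property (φ 1).hom ((φ 0).hom.hom.hom.hom x₀)
  obtain ⟨R, r₀, a, b, hR, ha, hb⟩ := exists_testObj hG (X 0).obj (X 1).obj x₀ x₁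
  have hB : IsNonemptyObj (⟨R, hR⟩ : ConnectedPart (BTempRel G H)) :=
    isNonemptyObj_of_isNonemptyObj hG (X 0) ⟨R, hR⟩ (hne 0)
  refine hsep (show (0 : Fin 2) ≠ 1 by decide) hB (ObjectProperty.homMk a)
    (ObjectProperty.homMk b) ?_
  apply ObjectProperty.hom_ext
  apply hom_eq_of_apply_eq hR _ _ r₀
  change ((φ 0).hom.hom.hom.hom (a.hom.hom.hom r₀) : A.obj.obj.obj.V) =
    (φ 1).hom.hom.hom.hom (b.hom.hom.hom r₀)
  rw [ha, hb, hx₁]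

/-- `ConnectedPartIsOfStronglyIndissectibleType` — `_holds` alias of `connectedPartIsOfStronglyIndissectibleType_holds` above under the fact's exact name (appended
2026-08-28, D-0026 bookkeeping: the proof term is the existing theorem of this file; no statement,
definition or attribute is edited; no new named fact; the ledger's debt table listed the fact
unproved). [cite: MochizukiFrdII2008, Ex 1.3 (i) p.11] -/
theorem _root_.Literature.AlgebraicGeometry.Frobenioids.QuasiTemperoid.ConnectedPartIsOfStronglyIndissectibleType_holds :
    ConnectedPartIsOfStronglyIndissectibleType G :=
  _root_.Literature.AlgebraicGeometry.Frobenioids.QuasiTemperoid.connectedPartIsOfStronglyIndissectibleType_holds (G := G)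

end QuasiTemperoid

end Literature.AlgebraicGeometry.Frobenioids
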